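import Summits.ValiantsHypothesis.ValiantsHypothesis.Theorems.BarrierLeverTransversalMinorLayoutsHeightEngine
import Summits.ValiantsHypothesis.ValiantsHypothesis.Theorems.BarrierLeverTransversalMinorLayoutsHeightFourBridge
import Summits.ValiantsHypothesis.ValiantsHypothesis.Theorems.BarrierLeverTransversalMinorLayoutsRankSeven
import Summits.ValiantsHypothesis.ValiantsHypothesis.Theorems.BarrierLeverTransversalMinorLayoutsLockedCertsEightB
import Summits.ValiantsHypothesis.ValiantsHypothesis.Theorems.BarrierLeverTransversalMinorLayoutsLockedCertsHeightFour

/-!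
# Route BarrierLever — conjecture TT (stmt-ValiantsHypothesis-19152) for EVERY layout of height `h ≤ 4`
# (all numbers of rows `r`)

Helper file (`--supports stmt-ValiantsHypothesis-19152`; cell valiant-natproofs, rung V4, 𝒟-side of
door (c); seat val-np-p4 gen 10).  Closes NO item.  Conventions of item 19152 (`u w : Fin r → Finset
(Fin h)` injective; row literal `castAdd a` / `natAdd a` by `a ∈ u i`; column literal `natAdd c` /
`castAdd c` by `c ∈ w j`; GOOD = some `H` makes the `r × r` matrix of transversal minors nonsingular).

* The locked-core engine in HEIGHT form (`tt_height_le_of_lockedCore`, file `…HeightEngine`) reduces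
  «GOOD for every injective pair of height `h ≤ 4`» to the LOCKED pairs of injective lower-set layouts
  (simplicial complexes) at heights `h ≤ 4`, `h < r` — locked: no literal class `{i : (a ∈ u i) = β}`
  of the rows has the size of a literal class of the columns.
* `h ≤ 3`: tree (`PPSmall.transversalMinorLayouts_nonsingular_of_le_three`, val-np-p1 g7).
* `h = 4`, `r ≤ 7`: tree (`transversalMinorLayouts_nonsingular_of_r_le_seven`, val-np-p1 g8).
* `h = 4`, `r ≥ 8`: the COMBINATORICS OF DOWN-SETS OF `2^[4]` is decided in the kernel in a CODED form:
  a complex with `r ≥ 9` faces contains `∅` and the four vertices (`exists_eq_singleton_of_eight_lt`),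
  so it is `{∅, {0}, {1}, {2}, {3}} ∪ BIG(t)` for the set `t ⊆ Fin 11` of codes of its big faces
  (`BIG = ![01, 02, 12, 012, 03, 13, 013, 23, 023, 123, 0123]`); lower-set-ness, the vertex DEGREES
  `#{i : a ∈ u i}` and the `S₄`-types are read off `t` (`coded_lower`, `coded_card`, `coded_degree`,
  `faces_map_of_coded`), and three `decide`s over `t : Finset (Fin 11)` (companion file
  `…TransversalMinorLayoutsHeightFourCoded`, imports only Mathlib) classify:
  `r = 8` (with all vertices): triangle+point (degrees `1,3,3,3`) / star (`4,2,2,2`) / path (`2,2,3,3`);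
  `r = 9`: cube+point (`4,4,4,1`) / cone-type (`4,3,3,2`) / four-cycle `C₄` (`3,3,3,3`);
  `r ≥ 10`: some vertex has degree `d(r) = 4,4,4,5,6,7,8` (`r = 10,…,16`).
  Hence the LOCKED pairs at `h = 4` are: `r = 8` — the full `3`-cube (a vertex missing) against
  triangle+point or path, triangle+point against star (certificates of val-np-p1 g8,
  `…LockedCertsEightB`); `r = 9` — cube+point against `C₄` (`cubePt_v_c4_h4_derivable`,
  `…LockedCertsHeightFour`); none for `r ≥ 10` (a common degree unlocks).  The certificates are
  transported to every placement by `good_of_ppDerivable_relabel` and `tt_layout_swap`.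
* `transversalMinorLayouts_nonsingular_of_h_le_four` — **TT for every injective layout pair of height
  `h ≤ 4`, every `r`** (conclusion of item 19152 verbatim for these layouts).

The seat enumeration behind the three `decide`s (168 down-sets, 30 `S₄`-types, locked pairs) is
work/h4_locked.py / work/gen_tables.py of the seat folder; the `decide`s re-verify everything used.
Companions: `…HeightFourCoded` (tables and the three `decide`s), `…HeightFourBridge` (the bridge from a
layout to its code set: `coded_lower`, `coded_card`, `coded_degree`, `faces_map_of_coded`,
`faces_map_of_missing`).  This file: the case analysis of the locked pairs at `h = 4` (`good_h4_r8`,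
`good_h4_r9`, `not_locked_h4_of_ten_le`, `good_h4_locked`) and the assembly.

WHAT THIS IS NOT: a height slice of TT (orthogonal to the rank slices `r ≤ 7`); nothing on TT / items
19761 / 19930 in general, on crux stmt-ValiantsHypothesis-14610, or on `VP` versus `VNP`.
-/

-- layout Summits/ValiantsHypothesis/ValiantsHypothesis forces the duplicated namespace component
set_option linter.dupNamespace false

open Matrix Finset

namespace Summit.ValiantsHypothesis.ValiantsHypothesis.Theorems.BarrierLever.FiniteCheck

open Summit.ValiantsHypothesis.ValiantsHypothesis.Theorems.BarrierLever.PriorityPeeling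

/-! ## 1. The locked pairs at height `4` -/

/-- **`r = 8`.**  Either a vertex is missing on a side (then that side is a full `3`-cube and the other
side, if it has all vertices, is a triangle+point, a path — val-np-p1's certificates — or a star, this
seat's `cube3_v_star_h4_derivable`; two missing vertices share the degree `0`), or both sides have all
vertices and the only locked combination is triangle+point against star. -/
theorem good_h4_r8 (u w : Fin 8 → Finset (Fin 4)) (hu : Function.Injective u)
    (hw : Function.Injective w) (hlu : IsLowerSet (Set.range u)) (hlw : IsLowerSet (Set.range w))
    (hlk : (∀ (a c : Fin 4) (β γ : Bool),
      (Finset.univ.filter fun i => (a ∈ u i ↔ β = true)).card ≠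
        (Finset.univ.filter fun j => (c ∈ w j ↔ γ = true)).card)) :
    ∃ H : Matrix (Fin (4 + 4)) (Fin (4 + 4)) ℂ, (Matrix.of fun i j : Fin 8 => (H.submatrix
      (fun b : Fin 4 => if b ∈ u i then Fin.castAdd 4 b else Fin.natAdd 4 b)
      (fun b : Fin 4 => if b ∈ w j then Fin.natAdd 4 b else Fin.castAdd 4 b)).det).det ≠ 0 := by
  classical
  by_cases hU : ∃ a, ∀ i, u i ≠ {a}
  · obtain ⟨a, ha⟩ := hU
    by_cases hW : ∃ c, ∀ j, w j ≠ {c}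
    · obtain ⟨c, hc⟩ := hW
      exact (not_locked_of_degree_eq u w a c
        (by rw [degree_zero_of_missing u hlu a ha, degree_zero_of_missing w hlw c hc]) hlk).elim
    · push Not at hW
      have hcw := coded_card w hw hlw (by omega) hW
      obtain h | h | h := h4_coded_r8 _ (by omega) (coded_lower w hlw)
      · -- cube (rows) against triangle+point (columns): swap val-np-p1's `triangleIso_v_simplex`
        obtain ⟨⟨k, hgT⟩, -, -⟩ := h
        obtain ⟨π, hπ⟩ := h4_perm_of_tab k
        exact tt_layout_swap 4 8 u w (good_of_ppDerivable_relabel w u (![∅, {0}, {1}, {2}, {3}, {0, 1}, {0, 2}, {1, 2}] : Fin 8 → Finset (Fin 4)) (![∅, {0}, {1}, {2}, {0, 1}, {0, 2}, {1, 2}, {0, 1, 2}] : Fin 8 → Finset (Fin 4)) hw hu π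
          (Equiv.swap a 3)
          (faces_map_of_coded w hW π _ hπ _ _ h4_triPt_faces.1 h4_triPt_faces.2.1
            h4_triPt_faces.2.2 hgT)
          (faces_map_of_missing u hlu a ha _ h4_simplex_faces) triangleIso_v_simplex_h4_derivable)
      · -- cube against star: this seat's certificate
        obtain ⟨⟨k, hgT⟩, -, -⟩ := h
        obtain ⟨π, hπ⟩ := h4_perm_of_tab k
        exact good_of_ppDerivable_relabel u w (![∅, {0}, {1}, {0, 1}, {2}, {0, 2}, {1, 2}, {0, 1, 2}] : Fin 8 → Finset (Fin 4)) (![∅, {0}, {1}, {2}, {3}, {0, 1}, {0, 2}, {0, 3}] : Fin 8 → Finset (Fin 4)) hu hw (Equiv.swap a 3) π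
          (faces_map_of_missing u hlu a ha _ h4_cube3_faces)
          (faces_map_of_coded w hW π _ hπ _ _ h4_star_faces.1 h4_star_faces.2.1
            h4_star_faces.2.2 hgT) cube3_v_star_h4_derivable
      · -- cube against path: swap val-np-p1's `path4_v_simplex`
        obtain ⟨⟨k, hgT⟩, -, -⟩ := h
        obtain ⟨π, hπ⟩ := h4_perm_of_tab k
        exact tt_layout_swap 4 8 u w (good_of_ppDerivable_relabel w u (![∅, {0}, {1}, {2}, {3}, {0, 1}, {1, 2}, {2, 3}] : Fin 8 → Finset (Fin 4)) (![∅, {0}, {1}, {2}, {0, 1}, {0, 2}, {1, 2}, {0, 1, 2}] : Fin 8 → Finset (Fin 4)) hw hu π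
          (Equiv.swap a 3)
          (faces_map_of_coded w hW π _ hπ _ _ h4_path4_faces.1 h4_path4_faces.2.1
            h4_path4_faces.2.2 hgT)
          (faces_map_of_missing u hlu a ha _ h4_simplex_faces) path4_v_simplex_h4_derivable)
  · push Not at hU
    have hcu := coded_card u hu hlu (by omega) hU
    by_cases hW : ∃ c, ∀ j, w j ≠ {c}
    · obtain ⟨c, hc⟩ := hW
      obtain h | h | h := h4_coded_r8 _ (by omega) (coded_lower u hlu)
      · obtain ⟨⟨k, hgT⟩, -, -⟩ := h
        obtain ⟨π, hπ⟩ := h4_perm_of_tab k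
        exact good_of_ppDerivable_relabel u w (![∅, {0}, {1}, {2}, {3}, {0, 1}, {0, 2}, {1, 2}] : Fin 8 → Finset (Fin 4)) (![∅, {0}, {1}, {2}, {0, 1}, {0, 2}, {1, 2}, {0, 1, 2}] : Fin 8 → Finset (Fin 4)) hu hw π (Equiv.swap c 3)
          (faces_map_of_coded u hU π _ hπ _ _ h4_triPt_faces.1 h4_triPt_faces.2.1
            h4_triPt_faces.2.2 hgT)
          (faces_map_of_missing w hlw c hc _ h4_simplex_faces) triangleIso_v_simplex_h4_derivable
      · obtain ⟨⟨k, hgT⟩, -, -⟩ := h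
        obtain ⟨π, hπ⟩ := h4_perm_of_tab k
        exact tt_layout_swap 4 8 u w (good_of_ppDerivable_relabel w u (![∅, {0}, {1}, {0, 1}, {2}, {0, 2}, {1, 2}, {0, 1, 2}] : Fin 8 → Finset (Fin 4)) (![∅, {0}, {1}, {2}, {3}, {0, 1}, {0, 2}, {0, 3}] : Fin 8 → Finset (Fin 4)) hw hu
          (Equiv.swap c 3) π
          (faces_map_of_missing w hlw c hc _ h4_cube3_faces)
          (faces_map_of_coded u hU π _ hπ _ _ h4_star_faces.1 h4_star_faces.2.1
            h4_star_faces.2.2 hgT) cube3_v_star_h4_derivable)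
      · obtain ⟨⟨k, hgT⟩, -, -⟩ := h
        obtain ⟨π, hπ⟩ := h4_perm_of_tab k
        exact good_of_ppDerivable_relabel u w (![∅, {0}, {1}, {2}, {3}, {0, 1}, {1, 2}, {2, 3}] : Fin 8 → Finset (Fin 4)) (![∅, {0}, {1}, {2}, {0, 1}, {0, 2}, {1, 2}, {0, 1, 2}] : Fin 8 → Finset (Fin 4)) hu hw π (Equiv.swap c 3)
          (faces_map_of_coded u hU π _ hπ _ _ h4_path4_faces.1 h4_path4_faces.2.1
            h4_path4_faces.2.2 hgT)
          (faces_map_of_missing w hlw c hc _ h4_simplex_faces) path4_v_simplex_h4_derivable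
    · push Not at hW
      have hcw := coded_card w hw hlw (by omega) hW
      have hdu := coded_degree u hu hU
      have hdw := coded_degree w hw hW
      obtain ⟨hisoU, ⟨a1, ha1⟩, ⟨a3, ha3⟩⟩ | ⟨hisoU, ⟨a2, ha2⟩, ⟨a4, ha4⟩⟩ | ⟨-, ⟨a2, ha2⟩, ⟨a3, ha3⟩⟩ :=
        h4_coded_r8 _ (by omega) (coded_lower u hlu) <;>
      obtain ⟨hisoW, ⟨c1, hc1⟩, ⟨c3, hc3⟩⟩ | ⟨hisoW, ⟨c2, hc2⟩, ⟨c4, hc4⟩⟩ | ⟨-, ⟨c2, hc2⟩, ⟨c3, hc3⟩⟩ :=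
        h4_coded_r8 _ (by omega) (coded_lower w hlw)
      · exact (not_locked_of_degree_eq u w a3 c3 (by rw [hdu, hdw, ha3, hc3]) hlk).elim
      · -- triangle+point against star: val-np-p1's certificate
        obtain ⟨k, hgT⟩ := hisoU
        obtain ⟨π, hπ⟩ := h4_perm_of_tab k
        obtain ⟨k', hgT'⟩ := hisoW
        obtain ⟨π', hπ'⟩ := h4_perm_of_tab k'
        exact good_of_ppDerivable_relabel u w (![∅, {0}, {1}, {2}, {3}, {0, 1}, {0, 2}, {1, 2}] : Fin 8 → Finset (Fin 4)) (![∅, {0}, {1}, {2}, {3}, {0, 1}, {0, 2}, {0, 3}] : Fin 8 → Finset (Fin 4)) hu hw π π'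
          (faces_map_of_coded u hU π _ hπ _ _ h4_triPt_faces.1 h4_triPt_faces.2.1
            h4_triPt_faces.2.2 hgT)
          (faces_map_of_coded w hW π' _ hπ' _ _ h4_star_faces.1
            h4_star_faces.2.1 h4_star_faces.2.2 hgT') triangleIso_v_star_h4_derivable
      · exact (not_locked_of_degree_eq u w a3 c3 (by rw [hdu, hdw, ha3, hc3]) hlk).elim
      · -- star against triangle+point: swap
        obtain ⟨k, hgT⟩ := hisoU
        obtain ⟨π, hπ⟩ := h4_perm_of_tab k
        obtain ⟨k', hgT'⟩ := hisoW
        obtain ⟨π', hπ'⟩ := h4_perm_of_tab k'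
        exact tt_layout_swap 4 8 u w (good_of_ppDerivable_relabel w u (![∅, {0}, {1}, {2}, {3}, {0, 1}, {0, 2}, {1, 2}] : Fin 8 → Finset (Fin 4)) (![∅, {0}, {1}, {2}, {3}, {0, 1}, {0, 2}, {0, 3}] : Fin 8 → Finset (Fin 4)) hw hu π' π
          (faces_map_of_coded w hW π' _ hπ' _ _ h4_triPt_faces.1
            h4_triPt_faces.2.1 h4_triPt_faces.2.2 hgT')
          (faces_map_of_coded u hU π _ hπ _ _ h4_star_faces.1 h4_star_faces.2.1
            h4_star_faces.2.2 hgT) triangleIso_v_star_h4_derivable)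
      · exact (not_locked_of_degree_eq u w a2 c2 (by rw [hdu, hdw, ha2, hc2]) hlk).elim
      · exact (not_locked_of_degree_eq u w a2 c2 (by rw [hdu, hdw, ha2, hc2]) hlk).elim
      · exact (not_locked_of_degree_eq u w a3 c3 (by rw [hdu, hdw, ha3, hc3]) hlk).elim
      · exact (not_locked_of_degree_eq u w a2 c2 (by rw [hdu, hdw, ha2, hc2]) hlk).elim
      · exact (not_locked_of_degree_eq u w a2 c2 (by rw [hdu, hdw, ha2, hc2]) hlk).elim

/-- **`r = 9`.**  All vertices are present on both sides; the only locked combination is cube+point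
against the four-cycle (this seat's `cubePt_v_c4_h4_derivable`), in either order. -/
theorem good_h4_r9 (u w : Fin 9 → Finset (Fin 4)) (hu : Function.Injective u)
    (hw : Function.Injective w) (hlu : IsLowerSet (Set.range u)) (hlw : IsLowerSet (Set.range w))
    (hlk : (∀ (a c : Fin 4) (β γ : Bool),
      (Finset.univ.filter fun i => (a ∈ u i ↔ β = true)).card ≠
        (Finset.univ.filter fun j => (c ∈ w j ↔ γ = true)).card)) :
    ∃ H : Matrix (Fin (4 + 4)) (Fin (4 + 4)) ℂ, (Matrix.of fun i j : Fin 9 => (H.submatrix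
      (fun b : Fin 4 => if b ∈ u i then Fin.castAdd 4 b else Fin.natAdd 4 b)
      (fun b : Fin 4 => if b ∈ w j then Fin.natAdd 4 b else Fin.castAdd 4 b)).det).det ≠ 0 := by
  classical
  have hU := exists_eq_singleton_of_eight_lt u hu hlu (by omega)
  have hW := exists_eq_singleton_of_eight_lt w hw hlw (by omega)
  have hcu := coded_card u hu hlu (by omega) hU
  have hcw := coded_card w hw hlw (by omega) hW
  have hdu := coded_degree u hu hU
  have hdw := coded_degree w hw hW
  obtain ⟨hisoU, ⟨a4, ha4⟩⟩ | ⟨⟨a3, ha3⟩, ⟨a4, ha4⟩⟩ | ⟨hisoU, ⟨a3, ha3⟩⟩ :=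
    h4_coded_r9 _ (by omega) (coded_lower u hlu) <;>
  obtain ⟨hisoW, ⟨c4, hc4⟩⟩ | ⟨⟨c3, hc3⟩, ⟨c4, hc4⟩⟩ | ⟨hisoW, ⟨c3, hc3⟩⟩ :=
    h4_coded_r9 _ (by omega) (coded_lower w hlw)
  · exact (not_locked_of_degree_eq u w a4 c4 (by rw [hdu, hdw, ha4, hc4]) hlk).elim
  · exact (not_locked_of_degree_eq u w a4 c4 (by rw [hdu, hdw, ha4, hc4]) hlk).elim
  · -- cube+point against the four-cycle
    obtain ⟨k, hgT⟩ := hisoU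
    obtain ⟨π, hπ⟩ := h4_perm_of_tab k
    obtain ⟨k', hgT'⟩ := hisoW
    obtain ⟨π', hπ'⟩ := h4_perm_of_tab k'
    exact good_of_ppDerivable_relabel u w (![∅, {0}, {1}, {2}, {0, 1}, {0, 2}, {1, 2}, {0, 1, 2}, {3}] : Fin 9 → Finset (Fin 4)) (![∅, {0}, {1}, {2}, {3}, {0, 1}, {0, 2}, {1, 3}, {2, 3}] : Fin 9 → Finset (Fin 4)) hu hw π π'
      (faces_map_of_coded u hU π _ hπ _ _ h4_cubePt_faces.1 h4_cubePt_faces.2.1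
        h4_cubePt_faces.2.2 hgT)
      (faces_map_of_coded w hW π' _ hπ' _ _ h4_c4_faces.1 h4_c4_faces.2.1
        h4_c4_faces.2.2 hgT') cubePt_v_c4_h4_derivable
  · exact (not_locked_of_degree_eq u w a4 c4 (by rw [hdu, hdw, ha4, hc4]) hlk).elim
  · exact (not_locked_of_degree_eq u w a4 c4 (by rw [hdu, hdw, ha4, hc4]) hlk).elim
  · exact (not_locked_of_degree_eq u w a3 c3 (by rw [hdu, hdw, ha3, hc3]) hlk).elim
  · -- four-cycle against cube+point: swap
    obtain ⟨k, hgT⟩ := hisoU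
    obtain ⟨π, hπ⟩ := h4_perm_of_tab k
    obtain ⟨k', hgT'⟩ := hisoW
    obtain ⟨π', hπ'⟩ := h4_perm_of_tab k'
    exact tt_layout_swap 4 9 u w (good_of_ppDerivable_relabel w u (![∅, {0}, {1}, {2}, {0, 1}, {0, 2}, {1, 2}, {0, 1, 2}, {3}] : Fin 9 → Finset (Fin 4)) (![∅, {0}, {1}, {2}, {3}, {0, 1}, {0, 2}, {1, 3}, {2, 3}] : Fin 9 → Finset (Fin 4)) hw hu π' π
      (faces_map_of_coded w hW π' _ hπ' _ _ h4_cubePt_faces.1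
        h4_cubePt_faces.2.1 h4_cubePt_faces.2.2 hgT')
      (faces_map_of_coded u hU π _ hπ _ _ h4_c4_faces.1 h4_c4_faces.2.1
        h4_c4_faces.2.2 hgT) cubePt_v_c4_h4_derivable)
  · exact (not_locked_of_degree_eq u w a3 c3 (by rw [hdu, hdw, ha3, hc3]) hlk).elim
  · exact (not_locked_of_degree_eq u w a3 c3 (by rw [hdu, hdw, ha3, hc3]) hlk).elim

/-- **`r ≥ 10`: no locked pair** (both sides have a vertex of degree `d(r)`). -/
theorem not_locked_h4_of_ten_le {r : ℕ} (hr : 10 ≤ r) (u w : Fin r → Finset (Fin 4))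
    (hu : Function.Injective u) (hw : Function.Injective w) (hlu : IsLowerSet (Set.range u))
    (hlw : IsLowerSet (Set.range w)) (hlk : (∀ (a c : Fin 4) (β γ : Bool),
      (Finset.univ.filter fun i => (a ∈ u i ↔ β = true)).card ≠
        (Finset.univ.filter fun j => (c ∈ w j ↔ γ = true)).card)) : False := by
  classical
  have hU := exists_eq_singleton_of_eight_lt u hu hlu (by omega)
  have hW := exists_eq_singleton_of_eight_lt w hw hlw (by omega)
  have hcu := coded_card u hu hlu (by omega) hU
  have hcw := coded_card w hw hlw (by omega) hW
  obtain ⟨a, ha⟩ := h4_coded_r10 _ (by omega) (coded_lower u hlu)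
  obtain ⟨c, hc⟩ := h4_coded_r10 _ (by omega) (coded_lower w hlw)
  have hcards : ((Finset.univ.filter fun x : Fin 11 => ∃ i, u i = (![{0, 1}, {0, 2}, {1, 2}, {0, 1, 2}, {0, 3}, {1, 3}, {0, 1, 3}, {2, 3}, {0, 2, 3}, {1, 2, 3}, {0, 1, 2, 3}] : Fin 11 → Finset (Fin 4)) x)).card = ((Finset.univ.filter fun x : Fin 11 => ∃ i, w i = (![{0, 1}, {0, 2}, {1, 2}, {0, 1, 2}, {0, 3}, {1, 3}, {0, 1, 3}, {2, 3}, {0, 2, 3}, {1, 2, 3}, {0, 1, 2, 3}] : Fin 11 → Finset (Fin 4)) x)).card := by omega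
  refine not_locked_of_degree_eq u w a c ?_ hlk
  rw [coded_degree u hu hU, coded_degree w hw hW, ha, hc, hcards]

/-- **The locked core at height `4`.** -/
theorem good_h4_locked (r : ℕ) (hr : 4 < r) (u w : Fin r → Finset (Fin 4))
    (hu : Function.Injective u) (hw : Function.Injective w) (hlu : IsLowerSet (Set.range u))
    (hlw : IsLowerSet (Set.range w)) (hlk : (∀ (a c : Fin 4) (β γ : Bool),
      (Finset.univ.filter fun i => (a ∈ u i ↔ β = true)).card ≠
        (Finset.univ.filter fun j => (c ∈ w j ↔ γ = true)).card)) :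
    ∃ H : Matrix (Fin (4 + 4)) (Fin (4 + 4)) ℂ, (Matrix.of fun i j : Fin r => (H.submatrix
      (fun b : Fin 4 => if b ∈ u i then Fin.castAdd 4 b else Fin.natAdd 4 b)
      (fun b : Fin 4 => if b ∈ w j then Fin.natAdd 4 b else Fin.castAdd 4 b)).det).det ≠ 0 := by
  rcases (by omega : r ≤ 7 ∨ r = 8 ∨ r = 9 ∨ 10 ≤ r) with h7 | h8 | h9 | h10
  · exact transversalMinorLayouts_nonsingular_of_r_le_seven 4 r h7 u w hu hw
  · subst h8
    exact good_h4_r8 u w hu hw hlu hlw hlk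
  · subst h9
    exact good_h4_r9 u w hu hw hlu hlw hlk
  · exact (not_locked_h4_of_ten_le h10 u w hu hw hlu hlw hlk).elim

/-! ## 2. TT for every layout of height `h ≤ 4` -/

/-- **TT (item 19152) for EVERY injective layout pair of height `h ≤ 4`, every number of rows `r`.** -/
theorem transversalMinorLayouts_nonsingular_of_h_le_four (h r : ℕ) (hh : h ≤ 4)
    (u w : Fin r → Finset (Fin h)) (hu : Function.Injective u) (hw : Function.Injective w) :
    ∃ H : Matrix (Fin (h + h)) (Fin (h + h)) ℂ, (Matrix.of fun i j : Fin r => (H.submatrix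
      (fun a : Fin h => if a ∈ u i then Fin.castAdd h a else Fin.natAdd h a)
      (fun c : Fin h => if c ∈ w j then Fin.natAdd h c else Fin.castAdd h c)).det).det ≠ 0 := by
  refine tt_height_le_of_lockedCore 4 (fun h r hh4 hhr u w hu hw hlu hlw hlk => ?_) h hh r u w hu hw
  by_cases h3 : h ≤ 3
  · exact PPSmall.transversalMinorLayouts_nonsingular_of_le_three h r h3 u w hu hw
  · obtain rfl : h = 4 := by omega
    exact good_h4_locked r hhr u w hu hw hlu hlw hlk

end Summit.ValiantsHypothesis.ValiantsHypothesis.Theorems.BarrierLever.FiniteCheck
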